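import Summits.BirchSwinnertonDyer.BirchSwinnertonDyer.Theorems.ManinLocalTwoThreeGenerationDegeneracyImage
import HarnessLib

/-!
# Route `ManinLocalTwoThree`, cruxes C2 (stmt-BirchSwinnertonDyer-22967) / C3 (stmt-BirchSwinnertonDyer-22968): the
# generation laws as statements about `𝔽_p`-valued FUNCTIONALS on `Λ_f` — «every additive `φ : Λ_f → 𝔽_p` vanishing on the
# oldform lattice `Λ_h` vanishes» (the `f`-component of the cohomological form `{φ ∈ H¹ : π_t^*φ = π_1^*φ}[𝔪_f] = 0` of
# MEMO-es §21) ⟺ «some `m`, `p ∤ m`, has `m·Λ_f ⊆ Λ_h`» (line prover p3; helper, unconditional)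

* `exists_mul_subset_of_forall_functional_eq_zero` — LATTICE NAKAYAMA: for a finitely generated subgroup `Λ ⊆ ℂ`, a subgroup
  `Λ' ⊆ Λ` and a prime `p`: if every additive `φ : Λ → ZMod p` vanishing on `Λ'` is zero, then `m·Λ ⊆ Λ'` for some `m`
  with `p ∤ m` (`Λ/Λ'` has no `𝔽_p`-quotient, so `Λ/Λ' = p·(Λ/Λ')`, Nakayama over `ℤ`:
  `Submodule.exists_sub_one_mem_and_smul_eq_zero_of_fg_of_le_smul`);
* `forall_functional_eq_zero_of_mul_subset` — the converse;
* `shiftClassGenerationThree_iff_functionals`, `multiShiftClassGenerationTwo_iff_functionals` — **E-es-19 / E-es-22 ⟺ for every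
  `W`-newform `f` (level hypotheses as in the leaves), every additive `φ : Λ_f → 𝔽_3` (resp. `𝔽_2`) vanishing on
  `Λ_{f∣ι₃ − f∣ι₁}` (resp. `Λ_{h₂}`) is zero.**
This is the `f`-level half of the «dictionary» stub S2 of the es line `shiftgen3-diamond-split`; the other half (such a `φ`,
pulled back along Manin's `Γ₀(N) ↠ Λ_f`, is a parabolic-trivial, shift-invariant, Hecke-eigen cocycle with the NON-Eisenstein
system of `f`) is where the typed E-es-25 (T-es-12) enters.  Nothing about BSD, Manin's conjecture, E-es-19 or E-es-22 is proved here.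
-/

set_option autoImplicit false
set_option linter.dupNamespace false

noncomputable section

open scoped Classical MatrixGroups ModularForm BigOperators

open CongruenceSubgroup Matrix.SpecialLinearGroup ModularGroup
  Literature.NumberTheory.EllipticCurves Literature.NumberTheory.EllipticCurves.ModularForms
  Summit.BirchSwinnertonDyer.Rank1Residual.ManinAdditive

namespace Summit.BirchSwinnertonDyer.BirchSwinnertonDyer.Theorems.ManinLocalTwoThree

section LatticeNakayama

/-- **Lattice Nakayama.** Let `Λ ⊆ ℂ` be a finitely generated subgroup, `Λ' ⊆ Λ` a subgroup, `p` a prime. If every additive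
map `φ : Λ → ZMod p` that vanishes on (the elements of `Λ` lying in) `Λ'` is zero, then `m·Λ ⊆ Λ'` for some natural `m` with
`p ∤ m`. [folklore] -/
theorem exists_mul_subset_of_forall_functional_eq_zero (Λ Λ' : AddSubgroup ℂ) (hfg : Λ.FG) (p : ℕ) [Fact p.Prime]
    (H : ∀ φ : Λ →+ ZMod p, (∀ x : Λ, (x : ℂ) ∈ Λ' → φ x = 0) → φ = 0) :
    ∃ m : ℕ, ¬ p ∣ m ∧ ∀ x ∈ Λ, (m : ℂ) * x ∈ Λ' := by
  -- the ℤ-module `A = Λ`, its submodule `K = Λ ∩ Λ'`, the quotient `M = A ⧸ K`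
  haveI : Module.Finite ℤ Λ := Module.Finite.iff_addGroup_fg.mpr ((AddGroup.fg_iff_addSubgroup_fg Λ).mpr hfg)
  let K : Submodule ℤ Λ := (Λ'.addSubgroupOf Λ).toIntSubmodule
  have hK : ∀ x : Λ, x ∈ K ↔ (x : ℂ) ∈ Λ' := fun x => Iff.rfl
  haveI : Module.Finite ℤ (Λ ⧸ K) := Module.Finite.quotient ℤ K
  let I : Ideal ℤ := Ideal.span {(p : ℤ)}
  -- every element of `M = Λ ⧸ K` lies in `p • M`
  have hle : (⊤ : Submodule ℤ (Λ ⧸ K)) ≤ I • ⊤ := by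
    intro m _
    by_contra hm
    -- the `𝔽_p`-vector space `M' = M ⧸ pM`
    set P : Submodule ℤ (Λ ⧸ K) := I • ⊤ with hP
    have hpM' : ∀ y : (Λ ⧸ K) ⧸ P, p • y = 0 := by
      intro y
      obtain ⟨y, rfl⟩ := Submodule.mkQ_surjective P y
      rw [← map_nsmul, ← LinearMap.mem_ker, Submodule.ker_mkQ, hP, ← natCast_zsmul]
      exact Submodule.smul_mem_smul (Ideal.mem_span_singleton_self (p : ℤ)) Submodule.mem_top
    letI inst : Module (ZMod p) ((Λ ⧸ K) ⧸ P) := AddCommGroup.zmodModule hpM'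
    haveI hfree : Module.Free (ZMod p) ((Λ ⧸ K) ⧸ P) := Module.Free.of_divisionRing (ZMod p) ((Λ ⧸ K) ⧸ P)
    have b := @Module.Free.chooseBasis (ZMod p) ((Λ ⧸ K) ⧸ P) _ _ inst hfree
    haveI hproj : Module.Projective (ZMod p) ((Λ ⧸ K) ⧸ P) := Module.Projective.of_basis b
    have hm' : P.mkQ m ≠ 0 := by
      rwa [Ne, ← LinearMap.mem_ker, Submodule.ker_mkQ]
    refine hm' ((@Module.forall_dual_apply_eq_zero_iff ((Λ ⧸ K) ⧸ P) _ (ZMod p) _ inst hproj (P.mkQ m)).mp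
      fun φ => ?_)
    -- the induced functional on `Λ`
    let ψ : Λ →+ ZMod p :=
      φ.toAddMonoidHom.comp ((P.mkQ.toAddMonoidHom).comp K.mkQ.toAddMonoidHom)
    have hψK : ∀ x : Λ, (x : ℂ) ∈ Λ' → ψ x = 0 := by
      intro x hx
      show φ.toAddMonoidHom (P.mkQ (K.mkQ x)) = 0
      have : K.mkQ x = 0 := by rw [← LinearMap.mem_ker, Submodule.ker_mkQ]; exact (hK x).mpr hx
      rw [this, map_zero, map_zero]
    have hψ := H ψ hψK
    obtain ⟨x, hx⟩ := Submodule.mkQ_surjective K m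
    have : ψ x = 0 := by rw [hψ]; rfl
    rw [← hx]
    exact this
  -- Nakayama over `ℤ`
  obtain ⟨r, hr1, hr⟩ := Submodule.exists_sub_one_mem_and_smul_eq_zero_of_fg_of_le_smul I ⊤ Module.Finite.fg_top hle
  have hpr : ¬ (p : ℤ) ∣ r := by
    intro h
    have h1 : (p : ℤ) ∣ r - 1 := Ideal.mem_span_singleton.mp hr1
    have : (p : ℤ) ∣ 1 := by
      have := dvd_sub h h1
      rwa [sub_sub_cancel] at this
    exact (Nat.Prime.one_lt (Fact.out : p.Prime)).ne' (by exact_mod_cast Int.eq_one_of_dvd_one (by positivity) this)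
  -- `r • x ∈ Λ'` for all `x ∈ Λ`
  have hrx : ∀ x : Λ, ((r : ℂ)) * (x : ℂ) ∈ Λ' := by
    intro x
    have h := hr (K.mkQ x) Submodule.mem_top
    rw [← map_zsmul, ← LinearMap.mem_ker, Submodule.ker_mkQ, hK] at h
    simpa [zsmul_eq_mul] using h
  obtain ⟨k, hk⟩ := Int.eq_nat_or_neg r
  refine ⟨k, fun h => hpr ?_, fun x hx => ?_⟩
  · rcases hk with rfl | rfl
    · exact Int.natCast_dvd_natCast.mpr h
    · exact (Int.natCast_dvd_natCast.mpr h).neg_right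
  · have h := hrx ⟨x, hx⟩
    rcases hk with rfl | rfl
    · push_cast at h
      exact h
    · push_cast at h
      rw [neg_mul] at h
      exact neg_mem_iff.mp h

/-- The converse: if `m·Λ ⊆ Λ'` with `p ∤ m`, every additive `φ : Λ → ZMod p` vanishing on `Λ'` is zero
(`φ(x) = m⁻¹·φ(m x) = 0`). [folklore] -/
theorem forall_functional_eq_zero_of_mul_subset (Λ Λ' : AddSubgroup ℂ) (p : ℕ) [Fact p.Prime] {m : ℕ} (hm : ¬ p ∣ m)
    (hΛ : ∀ x ∈ Λ, (m : ℂ) * x ∈ Λ') (φ : Λ →+ ZMod p) (hφ : ∀ x : Λ, (x : ℂ) ∈ Λ' → φ x = 0) : φ = 0 := by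
  ext x
  have hmx : φ (m • x) = 0 := hφ (m • x) (by rw [AddSubgroupClass.coe_nsmul, nsmul_eq_mul]; exact hΛ x x.2)
  rw [map_nsmul, nsmul_eq_mul] at hmx
  have hunit : IsUnit ((m : ZMod p)) := by
    rw [ZMod.isUnit_iff_coprime]
    exact (Nat.Prime.coprime_iff_not_dvd (Fact.out : p.Prime)).mpr hm |>.symm
  rw [AddMonoidHom.zero_apply]
  exact (hunit.mul_right_eq_zero).mp hmx

end LatticeNakayama

/-! ### The generation laws as statements about `𝔽_p`-functionals on `Λ_f` -/

section Functionals

/-- **E-es-19 ⟺ no nonzero `𝔽₃`-functional on `Λ_f` kills the oldform lattice `Λ_{f∣ι₃ − f∣ι₁}`.** For every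
`W`-newform `f` with `9 ∣ N` and `W[3]` irreducible: every additive `φ : Λ_f → ZMod 3` vanishing on the elements of
`Λ_f` that lie in `Λ_h`, `h = degeneracyMap0 N (3N) 3 2 f − degeneracyMap0 N (3N) 1 2 f`, is zero — if and only if
`ShiftClassGenerationThree` (lattice Nakayama + `shiftClassGenerationThree_iff_oldformLattice`). [folklore] -/
theorem shiftClassGenerationThree_iff_functionals :
    ShiftClassGenerationThree ↔
      ∀ (W : WeierstrassCurve ℚ) [W.IsElliptic] {N : ℕ} [NeZero N] (f : CuspForm (Gamma0 N) 2),
        IsNewformOf W f → 3 ^ 2 ∣ N → W.HasIrreducibleModPGaloisRep 3 →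
        ∀ φ : ↥(periodLattice f) →+ ZMod 3,
          (∀ x : ↥(periodLattice f), (x : ℂ) ∈
              periodLattice (degeneracyMap0 N (3 * N) 3 2 f - degeneracyMap0 N (3 * N) 1 2 f) → φ x = 0) →
          φ = 0 := by
  haveI : Fact (Nat.Prime 3) := ⟨Nat.prime_three⟩
  rw [shiftClassGenerationThree_iff_oldformLattice]
  constructor
  · intro H W _ N _ f hf h9 hirr φ hφ
    obtain ⟨m, hm, hgen⟩ := H W f hf h9 hirr
    exact forall_functional_eq_zero_of_mul_subset _ _ 3 hm hgen φ hφ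
  · intro H W _ N _ f hf h9 hirr
    exact exists_mul_subset_of_forall_functional_eq_zero _ _ (periodLattice_fg f) 3 (H W f hf h9 hirr)

/-- **E-es-22 ⟺ no nonzero `𝔽₂`-functional on `Λ_f` kills the oldform lattice `Λ_{h₂}`**, `h₂ = Σ_T (−1)^{|T|} ι_{∏T} f` on
`Γ₀(8N²)`: for every `W`-newform `f` with `4 ∣ N` and `W[2]` irreducible, every additive `φ : Λ_f → ZMod 2` vanishing on
`Λ_f ∩ Λ_{h₂}` is zero — if and only if `MultiShiftClassGenerationTwo`. [folklore] -/
theorem multiShiftClassGenerationTwo_iff_functionals :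
    MultiShiftClassGenerationTwo ↔
      ∀ (W : WeierstrassCurve ℚ) [W.IsElliptic] {N : ℕ} [NeZero N] (f : CuspForm (Gamma0 N) 2),
        IsNewformOf W f → 2 ^ 2 ∣ N → W.HasIrreducibleModPGaloisRep 2 →
        ∀ φ : ↥(periodLattice f) →+ ZMod 2,
          (∀ x : ↥(periodLattice f), (x : ℂ) ∈
              periodLattice (∑ T ∈ (insert 8 (N.primeFactors.filter fun q => ¬ q ^ 2 ∣ N)).powerset,
                (-1 : ℂ) ^ T.card • degeneracyMap0 N (8 * N ^ 2) (∏ t ∈ T, t - 1 + 1) 2 f) → φ x = 0) →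
          φ = 0 := by
  haveI : Fact (Nat.Prime 2) := ⟨Nat.prime_two⟩
  rw [multiShiftClassGenerationTwo_iff_oldformLattice]
  constructor
  · intro H W _ N _ f hf h4 hirr φ hφ
    obtain ⟨m, hm, hgen⟩ := H W f hf h4 hirr
    exact forall_functional_eq_zero_of_mul_subset _ _ 2 hm hgen φ hφ
  · intro H W _ N _ f hf h4 hirr
    exact exists_mul_subset_of_forall_functional_eq_zero _ _ (periodLattice_fg f) 2 (H W f hf h4 hirr)

end Functionals

end Summit.BirchSwinnertonDyer.BirchSwinnertonDyer.Theorems.ManinLocalTwoThree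

end
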